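import Summits.CriticalPhenomena.PercolationContinuityZ3.Theorems.PercNearOneGluingNoHeavyLowerTailSunflowerPowerCertificate

/-!
# (RES0′) for every number of petals from a one-petal power certificate — model form (seven Lemma-A budgets)

Model (g52 §0): parameters `τ, σ, s`, floors `α₀₀ ≤ α₀₁ ≤ α₁₁`, constant `c₀ ≥ 0`; `p = τ(1−σ)`, `q = s(1−τ)`, `b_Ȳ = (1−s)α₀₀ + sα₀₁`,
`b_H = (1−σ)α₀₁ + σα₁₁`, `w_f = (1−τ)b_H + τ(σ + (1−σ)α₀₁)`, `g = c₀ + p b_Ȳ + q b_H`, `a = c₀ + p + q`; petal `(y,k,g,h)` with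
`α₀₀ ≤ y ≤ k ≤ 1`, `α₀₁ ≤ g ≤ min(k,h)`, `α₁₁ ≤ h ≤ 1`; `G = c₀ + pȲ + qH`, `Ȳ = (1−s)y + sk`, `H = (1−σ)g + σh`, `W = (1−τ)H + τ(σ + (1−σ)k)`.
The SEVEN budgets: the cells `y, k, g, h` and the faces Ȳ = {z1=1,u=0}, H = {z1=0,w=1}, W = {w=1} of the block (z1,u,w)
(`∏ u_j ≤ floor^(n−1)·full` for each; prove-1 g55 memo §3, §6(a): W is the face that makes the fractional relaxation (nearly) tight).

**`res0_of_power_certificate7`.**  If exponents `λ = (λ_y, λ_k, λ_g, λ_h, λ_Ȳ, λ_H, λ_W) ≥ 0` satisfy the ONE-PETAL inequality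
`G(y,k,g,h)/g ≤ (y/α₀₀)^λ_y (k/α₀₁)^λ_k (g/α₀₁)^λ_g (h/α₁₁)^λ_h (Ȳ/b_Ȳ)^λ_Ȳ (H/b_H)^λ_H (W/w_f)^λ_W` for every petal, and the cap condition
`(1/α₀₀)^λ_y (1/α₀₁)^λ_k (1/α₀₁)^λ_g (1/α₁₁)^λ_h (1/b_Ȳ)^λ_Ȳ (1/b_H)^λ_H (1/w_f)^λ_W ≤ a/g`, then EVERY nonempty family obeying the seven budgets has
`∏ G_j ≤ g^(n−1)·a`.  (Instance of `prod_le_of_power_certificate`; numerically such λ exist at > 99 % of parameter points, memo §3(c), kit j230206.)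
[this work]
-/

namespace Summit.CriticalPhenomena.PercolationContinuityZ3.Theorems.SunflowerPartition.SafeCalc.LinkedCurrency

open Finset

set_option maxHeartbeats 800000 in
/-- **(RES0′) ∀n from a seven-budget power certificate** (see the module docstring). [this work] -/
theorem res0_of_power_certificate7 {κ : Type*} [DecidableEq κ] {τ σ s α00 α01 α11 c0 : ℝ} (hτ0 : 0 < τ) (hτ1 : τ < 1)
    (hσ0 : 0 ≤ σ) (hσ1 : σ < 1) (hs0 : 0 ≤ s) (hs1 : s ≤ 1) (hα00 : 0 < α00) (h01 : α00 ≤ α01) (h11 : α01 ≤ α11) (hc0 : 0 ≤ c0)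
    (ly lk lg lh lY lH lW : ℝ) (hly : 0 ≤ ly) (hlk : 0 ≤ lk) (hlg : 0 ≤ lg) (hlh : 0 ≤ lh) (hlY : 0 ≤ lY) (hlH : 0 ≤ lH) (hlW : 0 ≤ lW)
    -- the one-petal certificate inequality
    (hcert : ∀ y k gc h : ℝ, α00 ≤ y → y ≤ k → k ≤ 1 → α01 ≤ gc → gc ≤ k → gc ≤ h → α11 ≤ h → h ≤ 1 →
      (c0 + τ * (1 - σ) * ((1 - s) * y + s * k) + s * (1 - τ) * ((1 - σ) * gc + σ * h)) /
          (c0 + τ * (1 - σ) * ((1 - s) * α00 + s * α01) + s * (1 - τ) * ((1 - σ) * α01 + σ * α11)) ≤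
        (y / α00) ^ ly * (k / α01) ^ lk * (gc / α01) ^ lg * (h / α11) ^ lh *
          (((1 - s) * y + s * k) / ((1 - s) * α00 + s * α01)) ^ lY *
          (((1 - σ) * gc + σ * h) / ((1 - σ) * α01 + σ * α11)) ^ lH *
          (((1 - τ) * ((1 - σ) * gc + σ * h) + τ * (σ + (1 - σ) * k)) /
              ((1 - τ) * ((1 - σ) * α01 + σ * α11) + τ * (σ + (1 - σ) * α01))) ^ lW)
    -- the cap condition
    (hcap : (1 / α00) ^ ly * (1 / α01) ^ lk * (1 / α01) ^ lg * (1 / α11) ^ lh * (1 / ((1 - s) * α00 + s * α01)) ^ lY *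
        (1 / ((1 - σ) * α01 + σ * α11)) ^ lH * (1 / ((1 - τ) * ((1 - σ) * α01 + σ * α11) + τ * (σ + (1 - σ) * α01))) ^ lW ≤
      (c0 + τ * (1 - σ) + s * (1 - τ)) / (c0 + τ * (1 - σ) * ((1 - s) * α00 + s * α01) + s * (1 - τ) * ((1 - σ) * α01 + σ * α11)))
    (S : Finset κ) (hS : S.Nonempty) (y k gc h : κ → ℝ)
    (hy : ∀ j ∈ S, α00 ≤ y j) (hyk : ∀ j ∈ S, y j ≤ k j) (hk1 : ∀ j ∈ S, k j ≤ 1) (hg : ∀ j ∈ S, α01 ≤ gc j)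
    (hgk : ∀ j ∈ S, gc j ≤ k j) (hgh : ∀ j ∈ S, gc j ≤ h j) (hh : ∀ j ∈ S, α11 ≤ h j) (hh1 : ∀ j ∈ S, h j ≤ 1)
    (hBy : ∏ j ∈ S, y j ≤ α00 ^ (S.card - 1)) (hBk : ∏ j ∈ S, k j ≤ α01 ^ (S.card - 1)) (hBg : ∏ j ∈ S, gc j ≤ α01 ^ (S.card - 1))
    (hBh : ∏ j ∈ S, h j ≤ α11 ^ (S.card - 1))
    (hBY : ∏ j ∈ S, ((1 - s) * y j + s * k j) ≤ ((1 - s) * α00 + s * α01) ^ (S.card - 1))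
    (hBH : ∏ j ∈ S, ((1 - σ) * gc j + σ * h j) ≤ ((1 - σ) * α01 + σ * α11) ^ (S.card - 1))
    (hBW : ∏ j ∈ S, ((1 - τ) * ((1 - σ) * gc j + σ * h j) + τ * (σ + (1 - σ) * k j)) ≤
      ((1 - τ) * ((1 - σ) * α01 + σ * α11) + τ * (σ + (1 - σ) * α01)) ^ (S.card - 1)) :
    ∏ j ∈ S, (c0 + τ * (1 - σ) * ((1 - s) * y j + s * k j) + s * (1 - τ) * ((1 - σ) * gc j + σ * h j)) ≤
      (c0 + τ * (1 - σ) * ((1 - s) * α00 + s * α01) + s * (1 - τ) * ((1 - σ) * α01 + σ * α11)) ^ (S.card - 1) *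
        (c0 + τ * (1 - σ) + s * (1 - τ)) := by
  have hα01 : 0 < α01 := lt_of_lt_of_le hα00 h01
  have hα11 : 0 < α11 := lt_of_lt_of_le hα01 h11
  have hp0 : 0 < τ * (1 - σ) := mul_pos hτ0 (by linarith)
  have hqnn : 0 ≤ s * (1 - τ) := mul_nonneg hs0 (by linarith)
  obtain ⟨bY, hbY⟩ : ∃ b, b = (1 - s) * α00 + s * α01 := ⟨_, rfl⟩
  obtain ⟨bH, hbH⟩ : ∃ b, b = (1 - σ) * α01 + σ * α11 := ⟨_, rfl⟩
  obtain ⟨wf, hwf⟩ : ∃ b, b = (1 - τ) * ((1 - σ) * α01 + σ * α11) + τ * (σ + (1 - σ) * α01) := ⟨_, rfl⟩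
  have hbY0 : 0 < bY := by
    rw [hbY]; rcases eq_or_lt_of_le hs1 with e | e
    · rw [e]; simpa using hα01
    · nlinarith [mul_pos (sub_pos.2 e) hα00, mul_nonneg hs0 hα01.le]
  have hbH0 : 0 < bH := by rw [hbH]; nlinarith [mul_pos (sub_pos.2 hσ1) hα01, mul_nonneg hσ0 hα11.le]
  rw [← hwf] at hBW hcert hcap
  rw [← hbY] at hBY hcert hcap ⊢; rw [← hbH] at hBH hcert hcap hwf ⊢
  have hwf0 : 0 < wf := by
    rw [hwf]; nlinarith [mul_pos (sub_pos.2 hτ1) hbH0, mul_nonneg hτ0.le (add_nonneg hσ0 (mul_nonneg (sub_nonneg.2 hσ1.le) hα01.le))]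
  obtain ⟨g, hgdef⟩ : ∃ t, t = c0 + τ * (1 - σ) * bY + s * (1 - τ) * bH := ⟨_, rfl⟩
  rw [← hgdef] at hcert hcap ⊢
  have hgpos : 0 < g := by rw [hgdef]; nlinarith [mul_pos hp0 hbY0, mul_nonneg hqnn hbH0.le]
  obtain ⟨n, hn⟩ : ∃ n, n = S.card := ⟨_, rfl⟩
  rw [← hn] at hBy hBk hBg hBh hBY hBH hBW ⊢
  have hcardS : S.card = n := hn.symm
  have hn1 : 1 ≤ n := by rw [hn]; exact Finset.card_pos.2 hS
  -- per-petal usage vector (seven budgets), caps, exponents — all as explicit `Fin 7`-vectors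
  have hu1 : ∀ j ∈ S, ∀ i ∈ (Finset.univ : Finset (Fin 7)),
      1 ≤ (![y j / α00, k j / α01, gc j / α01, h j / α11, ((1 - s) * y j + s * k j) / bY,
        ((1 - σ) * gc j + σ * h j) / bH, ((1 - τ) * ((1 - σ) * gc j + σ * h j) + τ * (σ + (1 - σ) * k j)) / wf] : Fin 7 → ℝ) i := by
    intro j hj i _
    have := hy j hj; have := hyk j hj; have := hg j hj; have := hgk j hj; have := hgh j hj; have := hh j hj
    fin_cases i
    · show 1 ≤ y j / α00; rw [le_div_iff₀ hα00]; linarith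
    · show 1 ≤ k j / α01; rw [le_div_iff₀ hα01]; linarith
    · show 1 ≤ gc j / α01; rw [le_div_iff₀ hα01]; linarith
    · show 1 ≤ h j / α11; rw [le_div_iff₀ hα11]; linarith
    · show 1 ≤ ((1 - s) * y j + s * k j) / bY
      rw [le_div_iff₀ hbY0, hbY]; nlinarith [mul_le_mul_of_nonneg_left (hy j hj) (sub_nonneg.2 hs1),
        mul_le_mul_of_nonneg_left (show α01 ≤ k j by linarith) hs0]
    · show 1 ≤ ((1 - σ) * gc j + σ * h j) / bH
      rw [le_div_iff₀ hbH0, hbH]; nlinarith [mul_le_mul_of_nonneg_left (hg j hj) (sub_nonneg.2 hσ1.le),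
        mul_le_mul_of_nonneg_left (hh j hj) hσ0]
    · show 1 ≤ ((1 - τ) * ((1 - σ) * gc j + σ * h j) + τ * (σ + (1 - σ) * k j)) / wf
      rw [le_div_iff₀ hwf0, hwf, hbH]
      nlinarith [mul_le_mul_of_nonneg_left (hg j hj) (sub_nonneg.2 hσ1.le), mul_le_mul_of_nonneg_left (hh j hj) hσ0,
        mul_le_mul_of_nonneg_left (show α01 ≤ k j by linarith) (mul_nonneg hτ0.le (sub_nonneg.2 hσ1.le)), sub_pos.2 hτ1]
  have hV0 : ∀ j ∈ S, 0 ≤ (c0 + τ * (1 - σ) * ((1 - s) * y j + s * k j) + s * (1 - τ) * ((1 - σ) * gc j + σ * h j)) / g :=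
    fun j hj => by
    apply div_nonneg _ hgpos.le
    have hy0 : 0 ≤ y j := hα00.le.trans (hy j hj)
    have hk0 : 0 ≤ k j := hy0.trans (hyk j hj)
    nlinarith [mul_nonneg hp0.le (add_nonneg (mul_nonneg (sub_nonneg.2 hs1) hy0) (mul_nonneg hs0 hk0)),
      mul_nonneg hqnn (add_nonneg (mul_nonneg (sub_nonneg.2 hσ1.le) (hα01.le.trans (hg j hj))) (mul_nonneg hσ0 (hα11.le.trans (hh j hj))))]
  have hcert' : ∀ j ∈ S, (c0 + τ * (1 - σ) * ((1 - s) * y j + s * k j) + s * (1 - τ) * ((1 - σ) * gc j + σ * h j)) / g ≤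
      ∏ i ∈ (Finset.univ : Finset (Fin 7)),
        ((![y j / α00, k j / α01, gc j / α01, h j / α11, ((1 - s) * y j + s * k j) / bY,
          ((1 - σ) * gc j + σ * h j) / bH, ((1 - τ) * ((1 - σ) * gc j + σ * h j) + τ * (σ + (1 - σ) * k j)) / wf] : Fin 7 → ℝ) i) ^
        ((![ly, lk, lg, lh, lY, lH, lW] : Fin 7 → ℝ) i) := by
    intro j hj
    rw [Fin.prod_univ_seven]
    show _ ≤ (y j / α00) ^ ly * (k j / α01) ^ lk * (gc j / α01) ^ lg * (h j / α11) ^ lh *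
          (((1 - s) * y j + s * k j) / bY) ^ lY * (((1 - σ) * gc j + σ * h j) / bH) ^ lH *
          (((1 - τ) * ((1 - σ) * gc j + σ * h j) + τ * (σ + (1 - σ) * k j)) / wf) ^ lW
    exact hcert (y j) (k j) (gc j) (h j) (hy j hj) (hyk j hj) (hk1 j hj) (hg j hj) (hgk j hj) (hgh j hj) (hh j hj) (hh1 j hj)
  have hpow : ∀ {b : ℝ}, 0 < b → ∀ {f : κ → ℝ}, ∏ j ∈ S, f j ≤ b ^ (n - 1) → ∏ j ∈ S, f j / b ≤ 1 / b := by
    intro b hb f hU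
    rw [Finset.prod_div_distrib, Finset.prod_const, hcardS, div_le_div_iff₀ (pow_pos hb n) hb]
    have e : b ^ n = b ^ (n - 1) * b := by rw [← pow_succ]; congr 1; omega
    rw [e]; nlinarith [mul_le_mul_of_nonneg_right hU hb.le]
  have hbudget : ∀ i ∈ (Finset.univ : Finset (Fin 7)),
      ∏ j ∈ S, (![y j / α00, k j / α01, gc j / α01, h j / α11, ((1 - s) * y j + s * k j) / bY,
          ((1 - σ) * gc j + σ * h j) / bH, ((1 - τ) * ((1 - σ) * gc j + σ * h j) + τ * (σ + (1 - σ) * k j)) / wf] : Fin 7 → ℝ) i ≤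
        (![1 / α00, 1 / α01, 1 / α01, 1 / α11, 1 / bY, 1 / bH, 1 / wf] : Fin 7 → ℝ) i := by
    intro i _
    fin_cases i
    · show ∏ j ∈ S, y j / α00 ≤ 1 / α00; exact hpow hα00 hBy
    · show ∏ j ∈ S, k j / α01 ≤ 1 / α01; exact hpow hα01 hBk
    · show ∏ j ∈ S, gc j / α01 ≤ 1 / α01; exact hpow hα01 hBg
    · show ∏ j ∈ S, h j / α11 ≤ 1 / α11; exact hpow hα11 hBh
    · show ∏ j ∈ S, ((1 - s) * y j + s * k j) / bY ≤ 1 / bY; exact hpow hbY0 hBY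
    · show ∏ j ∈ S, ((1 - σ) * gc j + σ * h j) / bH ≤ 1 / bH; exact hpow hbH0 hBH
    · show ∏ j ∈ S, ((1 - τ) * ((1 - σ) * gc j + σ * h j) + τ * (σ + (1 - σ) * k j)) / wf ≤ 1 / wf; exact hpow hwf0 hBW
  have hlam0 : ∀ i ∈ (Finset.univ : Finset (Fin 7)), 0 ≤ (![ly, lk, lg, lh, lY, lH, lW] : Fin 7 → ℝ) i := by
    intro i _; fin_cases i
    · exact hly
    · exact hlk
    · exact hlg
    · exact hlh
    · exact hlY
    · exact hlH
    · exact hlW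
  have hT : ∏ i ∈ (Finset.univ : Finset (Fin 7)),
      ((![1 / α00, 1 / α01, 1 / α01, 1 / α11, 1 / bY, 1 / bH, 1 / wf] : Fin 7 → ℝ) i) ^ ((![ly, lk, lg, lh, lY, lH, lW] : Fin 7 → ℝ) i) ≤
      (c0 + τ * (1 - σ) + s * (1 - τ)) / g := by
    rw [Fin.prod_univ_seven]
    show (1 / α00) ^ ly * (1 / α01) ^ lk * (1 / α01) ^ lg * (1 / α11) ^ lh * (1 / bY) ^ lY * (1 / bH) ^ lH * (1 / wf) ^ lW ≤ _
    exact hcap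
  have main := prod_le_of_power_certificate (Finset.univ : Finset (Fin 7)) S
    (fun j => (![y j / α00, k j / α01, gc j / α01, h j / α11, ((1 - s) * y j + s * k j) / bY,
      ((1 - σ) * gc j + σ * h j) / bH, ((1 - τ) * ((1 - σ) * gc j + σ * h j) + τ * (σ + (1 - σ) * k j)) / wf] : Fin 7 → ℝ))
    (fun j => (c0 + τ * (1 - σ) * ((1 - s) * y j + s * k j) + s * (1 - τ) * ((1 - σ) * gc j + σ * h j)) / g)
    (![1 / α00, 1 / α01, 1 / α01, 1 / α11, 1 / bY, 1 / bH, 1 / wf]) (![ly, lk, lg, lh, lY, lH, lW]) _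
    hlam0 hu1 hV0 hcert' hbudget hT
  -- ∏ G_j / g ≤ a / g  ⟹  ∏ G_j ≤ g^(n-1) a
  have e1 : ∏ j ∈ S, (c0 + τ * (1 - σ) * ((1 - s) * y j + s * k j) + s * (1 - τ) * ((1 - σ) * gc j + σ * h j)) / g =
      (∏ j ∈ S, (c0 + τ * (1 - σ) * ((1 - s) * y j + s * k j) + s * (1 - τ) * ((1 - σ) * gc j + σ * h j))) / g ^ n := by
    rw [Finset.prod_div_distrib, Finset.prod_const, hcardS]
  rw [e1, div_le_div_iff₀ (pow_pos hgpos n) hgpos] at main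
  have e2 : g ^ n = g ^ (n - 1) * g := by rw [← pow_succ]; congr 1; omega
  rw [e2] at main
  nlinarith [pow_pos hgpos (n - 1), main]

end Summit.CriticalPhenomena.PercolationContinuityZ3.Theorems.SunflowerPartition.SafeCalc.LinkedCurrency
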